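import Literature.FieldTheory.Separability.FormallySmoothPrimeField
import Literature.NumberTheory.Transcendental.DerivationExtension
import Mathlib.RingTheory.Unramified.Basic
import Mathlib.FieldTheory.Perfect
import HarnessLib

/-!
# Every extension of a perfect field is formally smooth (Matsumura, Thm. 26.9 with Thm. 26.3)

Topic: `Literature/FieldTheory/Separability`. Matsumura, *Commutative Ring Theory*, Thm. 26.9:
"If `K` is a separable field extension of a field `k`, then `K` is 0-smooth, and conversely";
Thm. 26.3: "If `k` is a perfect field then every extension field `K` of `k` is separable over
`k`". Hence **every extension field of a perfect field is `0`-smooth (= formally smooth)** — with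
no finiteness hypothesis (Mathlib's `Algebra.FormallySmooth.of_perfectField` needs
`Algebra.EssFiniteType`, since it goes through separating transcendence bases, which need not
exist in general: Matsumura's Remark after Thm. 26.8, `K = k(x, x^{1/p}, x^{1/p²}, …)`).

PROVED here (`formallySmooth_of_perfectField`) from the two halves already in the tree:

* characteristic `p`: `K` is formally smooth over the prime field `𝔽_p`
  (`formallySmooth_zmod`, `FormallySmoothPrimeField.lean`), and a perfect field `k` is formally
  unramified over `𝔽_p` (`formallyUnramified_zmod_of_perfectRing`: `Ω_{k/𝔽_p} = 0` because
  `da = d(b^p) = p b^{p-1} db = 0` — Matsumura p. 204: "if `k₀ ⊂ k` is any perfect field contained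
  in `k` then `k^p(k₀) = k^p`", i.e. an absolute `p`-basis of `k` is a `p`-basis of `k/k₀`); so
  `K/k` is formally smooth by Mathlib's `Algebra.FormallySmooth.of_restrictScalars`
  (`𝔽_p → k → K`);
* characteristic `0`: `Literature.NumberTheory.Transcendental.formallySmooth_of_charZero`.

## References

* H. Matsumura, *Commutative Ring Theory*, Cambridge Stud. Adv. Math. 8, CUP 1986, §26:
  Thm. 26.3 (p. 200 = PDF p. 218 of the held copy `book:matsumura1986-commutative-ring-theory`),
  the remark on perfect subfields and Thm. 26.7 (p. 204 = PDF p. 221), Thm. 26.9 (p. 204 = PDF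
  p. 222). [Matsumura1987]
* A. Grothendieck, EGA 0_IV (Publ. Math. IHÉS 20, 1964), Thm. 19.6.1.
-/

noncomputable section

namespace Literature.FieldTheory.Separability

universe u v

/-- Over a perfect ring of characteristic `p`, the Kähler differentials relative to `𝔽_p`
vanish: `da = d(b^p) = p · b^{p-1} db = 0`. [cite: Matsumura1987, §26 p. 204 (an absolute
`p`-basis of a perfect field is empty)] -/
theorem kaehlerDifferential_eq_zero_of_perfectRing (p : ℕ) [Fact p.Prime] (k : Type u) [Field k]
    [CharP k p] [PerfectRing k p] [Algebra (ZMod p) k] (x : Ω[k⁄ZMod p]) : x = 0 := by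
  have h0 : ∀ a : k, KaehlerDifferential.D (ZMod p) k a = 0 := fun a => by
    obtain ⟨b, rfl⟩ := surjective_frobenius k p a
    rw [frobenius_def, Derivation.leibniz_pow, ← Nat.cast_smul_eq_nsmul k, CharP.cast_eq_zero,
      zero_smul]
  have hle : Submodule.span k (Set.range (KaehlerDifferential.D (ZMod p) k)) ≤ ⊥ :=
    Submodule.span_le.mpr (by
      rintro _ ⟨a, rfl⟩
      simp [h0 a])
  have hx : x ∈ Submodule.span k (Set.range (KaehlerDifferential.D (ZMod p) k)) := by
    rw [KaehlerDifferential.span_range_derivation]; trivial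
  exact (Submodule.mem_bot k).mp (hle hx)

/-- **A perfect field of characteristic `p` is formally unramified over `𝔽_p`** (`Ω_{k/𝔽_p} = 0`).
[cite: Matsumura1987, §26 p. 204, Thm. 26.7] -/
theorem formallyUnramified_zmod_of_perfectRing (p : ℕ) [Fact p.Prime] (k : Type u) [Field k]
    [CharP k p] [PerfectRing k p] [Algebra (ZMod p) k] : Algebra.FormallyUnramified (ZMod p) k :=
  ⟨⟨fun x y => by
    rw [kaehlerDifferential_eq_zero_of_perfectRing p k x,
      kaehlerDifferential_eq_zero_of_perfectRing p k y]⟩⟩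

/-- **Every extension field of a perfect field of characteristic `p` is formally smooth over it**
(`𝔽_p → k → K`: `K/𝔽_p` formally smooth, `k/𝔽_p` formally unramified).
[cite: Matsumura1987, Thm. 26.9, Thm. 26.3] -/
theorem formallySmooth_of_perfectField_of_charP (k : Type u) (K : Type v) [Field k] [Field K]
    [Algebra k K] [PerfectField k] (p : ℕ) [Fact p.Prime] [CharP k p] :
    Algebra.FormallySmooth k K := by
  haveI : CharP K p := charP_of_injective_algebraMap (algebraMap k K).injective p
  haveI : ExpChar k p := ExpChar.prime Fact.out
  letI : Algebra (ZMod p) k := ZMod.algebra k p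
  letI : Algebra (ZMod p) K := ZMod.algebra K p
  haveI : IsScalarTower (ZMod p) k K := IsScalarTower.of_algebraMap_eq fun x =>
    (RingHom.congr_fun
      (Subsingleton.elim ((algebraMap k K).comp (algebraMap (ZMod p) k)) (algebraMap (ZMod p) K))
      x).symm
  haveI : Algebra.FormallySmooth (ZMod p) K := formallySmooth_zmod K p
  haveI : Algebra.FormallyUnramified (ZMod p) k := formallyUnramified_zmod_of_perfectRing p k
  exact Algebra.FormallySmooth.of_restrictScalars (R := ZMod p) k K

/-- **Matsumura, Thm. 26.9 with Thm. 26.3: every extension field of a perfect field is formally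
smooth (0-smooth) over it**, without finiteness hypothesis (Mathlib's
`Algebra.FormallySmooth.of_perfectField` is the essentially-finite-type case).
[cite: Matsumura1987, Thm. 26.9, Thm. 26.3] -/
theorem formallySmooth_of_perfectField (k : Type u) (K : Type v) [Field k] [Field K] [Algebra k K]
    [PerfectField k] : Algebra.FormallySmooth k K := by
  obtain ⟨p, hp⟩ := CharP.exists k
  rcases CharP.char_is_prime_or_zero k p with h | h
  · haveI : Fact p.Prime := ⟨h⟩
    exact formallySmooth_of_perfectField_of_charP k K p
  · subst h
    haveI : CharZero k := CharP.charP_to_charZero k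
    exact Literature.NumberTheory.Transcendental.formallySmooth_of_charZero k K

end Literature.FieldTheory.Separability

end
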